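import Mathlib

/-!
# Self-horizon bound `3^H < |D|` (ENGINE B, pub-hlocus abs-2 g50) — helper anchor

certified instances and evidence bearing on the general Hodge conjecture; no claim.

Arithmetic core of THEOREM SELF-HORIZON (DERIVATIONS_engineB §67.3; the post hoc law F2 of g49, now derived).
If the Galois twist `g` moves the class `𝔞` and the twist horizon `H = H_g(𝔞) ≥ 1` is attained at the unit
`γ`, the trace dictionary of the census gives `D² - x² = 4·3^(H+1)·m` with `x` the trace at `γ`, `3 ∣ x`,
`x ≡ D (mod 2)`, `|x| < |D|`. Put `A = |D| - |x|`, `B = |D| + |x|`: both are multiples of 6 and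
`A + B = 2|D|` is NOT a multiple of 9 (D is fundamental with `3 ∥ D`). The lemmas below show that then one of
`A`, `B` is a multiple of `2·3^H` — so `3^H < |D|` — and that the other one is not a multiple of `3^(H+1)`
once `3 ∤ m` (the valuation split `{v₃ A, v₃ B} = {1, H}`). Registered check P-SH: 0 failures in 17 296 ζ₃ and
2 380 √3 maximising triples; the bound is tight (`B = 2·3^H` at |D| = 84, 255, 759, 2199).
-/

set_option linter.dupNamespace false

namespace Summit.HodgeConjecture.HodgeConjecture.HodgeLocus.Census.SelfHorizonB

/-- Transfer of the power of 3: if `3^(H+1) ∣ A * B`, `3 ∣ A` but `9 ∤ A`, then `3^H ∣ B`. -/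
theorem pow_dvd_of_shallow (A B H : ℕ) (h3 : 3 ^ (H + 1) ∣ A * B) (hA : 3 ∣ A) (h9A : ¬ 9 ∣ A) :
    3 ^ H ∣ B := by
  obtain ⟨a, rfl⟩ := hA
  have ha : ¬ 3 ∣ a := by
    rintro ⟨c, rfl⟩
    exact h9A ⟨c, by ring⟩
  have h1 : 3 * 3 ^ H ∣ 3 * (a * B) := by
    have : 3 ^ (H + 1) = 3 * 3 ^ H := by ring
    rw [this] at h3
    simpa [mul_assoc] using h3
  have h2 : 3 ^ H ∣ a * B := Nat.dvd_of_mul_dvd_mul_left (by norm_num) h1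
  have hcop : Nat.Coprime (3 ^ H) a :=
    Nat.Coprime.pow_left H ((Nat.Prime.coprime_iff_not_dvd Nat.prime_three).mpr ha)
  exact hcop.dvd_of_dvd_mul_left h2

/-- The valuation split: if `3^(H+1) ∣ A * B`, `3 ∣ A`, `3 ∣ B` and `9 ∤ A + B`, then `3^H` divides `A` or
`B` (exactly one of them is `≡ 0 mod 9` unless `H ≤ 1`). -/
theorem pow_dvd_or (A B H : ℕ) (h3 : 3 ^ (H + 1) ∣ A * B) (hA : 3 ∣ A) (hB : 3 ∣ B)
    (h9 : ¬ 9 ∣ A + B) : 3 ^ H ∣ A ∨ 3 ^ H ∣ B := by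
  by_cases h9A : 9 ∣ A
  · have h9B : ¬ 9 ∣ B := fun h => h9 (dvd_add h9A h)
    left
    have h3' : 3 ^ (H + 1) ∣ B * A := by rwa [mul_comm] at h3
    exact pow_dvd_of_shallow B A H h3' hB h9B
  · right
    exact pow_dvd_of_shallow A B H h3 hA h9A

/-- With the parity condition (`A`, `B` even) the deep factor is a multiple of `2·3^H`. -/
theorem two_mul_pow_dvd_or (A B H : ℕ) (h3 : 3 ^ (H + 1) ∣ A * B) (hA : 6 ∣ A) (hB : 6 ∣ B)
    (h9 : ¬ 9 ∣ A + B) : 2 * 3 ^ H ∣ A ∨ 2 * 3 ^ H ∣ B := by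
  have hA3 : 3 ∣ A := dvd_trans (by norm_num) hA
  have hB3 : 3 ∣ B := dvd_trans (by norm_num) hB
  have hA2 : 2 ∣ A := dvd_trans (by norm_num) hA
  have hB2 : 2 ∣ B := dvd_trans (by norm_num) hB
  have hcop : Nat.Coprime 2 (3 ^ H) := Nat.Coprime.pow_right H (by norm_num)
  rcases pow_dvd_or A B H h3 hA3 hB3 h9 with h | h
  · exact Or.inl (hcop.mul_dvd_of_dvd_of_dvd hA2 h)
  · exact Or.inr (hcop.mul_dvd_of_dvd_of_dvd hB2 h)

/-- Exactness of the split: if moreover `A * B = 4 * 3^(H+1) * m` with `3 ∤ m` and `A` is the shallow factor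
(`9 ∤ A`), then `B` carries `3^H` but not `3^(H+1)`. -/
theorem deep_exact (A B H m : ℕ) (hAB : A * B = 4 * 3 ^ (H + 1) * m) (hm : ¬ 3 ∣ m) (hA : 3 ∣ A)
    (h9A : ¬ 9 ∣ A) : 3 ^ H ∣ B ∧ ¬ 3 ^ (H + 1) ∣ B := by
  refine ⟨pow_dvd_of_shallow A B H ⟨4 * m, by rw [hAB]; ring⟩ hA h9A, ?_⟩
  intro hB
  have h1 : 3 * 3 ^ (H + 1) ∣ A * B := mul_dvd_mul hA hB
  rw [hAB] at h1
  have h2 : 3 ^ (H + 1) * 3 ∣ 3 ^ (H + 1) * (4 * m) := by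
    have e1 : 3 * 3 ^ (H + 1) = 3 ^ (H + 1) * 3 := by ring
    have e2 : 4 * 3 ^ (H + 1) * m = 3 ^ (H + 1) * (4 * m) := by ring
    rw [e1, e2] at h1
    exact h1
  have h3 : 3 ∣ 4 * m := Nat.dvd_of_mul_dvd_mul_left (pow_pos (by norm_num) _) h2
  have h4 : 3 ∣ m := (Nat.Coprime.dvd_of_dvd_mul_left (by norm_num : Nat.Coprime 3 4) h3)
  exact hm h4

/-- THEOREM SELF-HORIZON (the bound): with `A = d - t`, `B = d + t`, `t < d` (d = |D|, t = |x|),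
`3^(H+1) ∣ A * B`, `6 ∣ A`, `6 ∣ B`, `9 ∤ 2 d`: `3^H < d`. If the shallow factor is `B` (A-deep case) the
sharper `2·3^H + t ≤ d` holds. -/
theorem three_pow_lt (d t H : ℕ) (ht : t < d) (h3 : 3 ^ (H + 1) ∣ (d - t) * (d + t))
    (hA : 6 ∣ d - t) (hB : 6 ∣ d + t) (h9 : ¬ 9 ∣ 2 * d) : 3 ^ H < d := by
  have hsum : d - t + (d + t) = 2 * d := by omega
  have h9' : ¬ 9 ∣ d - t + (d + t) := by rwa [hsum]
  have hpos : 0 < 3 ^ H := pow_pos (by norm_num) H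
  rcases two_mul_pow_dvd_or (d - t) (d + t) H h3 hA hB h9' with h | h
  · have hle : 2 * 3 ^ H ≤ d - t := Nat.le_of_dvd (by omega) h
    omega
  · have hle : 2 * 3 ^ H ≤ d + t := Nat.le_of_dvd (by omega) h
    omega

/-- A-deep refinement: if the deep factor is `A = d - t` then `2·3^H + t ≤ d`. -/
theorem a_deep (d t H : ℕ) (ht : t < d) (h : 2 * 3 ^ H ∣ d - t) : 2 * 3 ^ H + t ≤ d := by
  have hle : 2 * 3 ^ H ≤ d - t := Nat.le_of_dvd (by omega) h
  omega

/-- Tightness witnesses from the census (|D| = 84, H = 4: B = 84 + 78 = 162 = 2·3^4, A = 6;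
|D| = 2199, H = 7: B = 2199 + 2175 = 4374 = 2·3^7, A = 24, m = 4). -/
theorem tight_84 : (84 - 78) * (84 + 78) = 4 * 3 ^ (4 + 1) * 1 ∧ 84 + 78 = 2 * 3 ^ 4 := by norm_num

/-- Tightness witness |D| = 2199, H = 7: `B = 2199 + 2175 = 4374 = 2·3^7`, `A = 24`, `m = 4`. -/
theorem tight_2199 : (2199 - 2175) * (2199 + 2175) = 4 * 3 ^ (7 + 1) * 4 ∧ 2199 + 2175 = 2 * 3 ^ 7 := by
  norm_num

end Summit.HodgeConjecture.HodgeConjecture.HodgeLocus.Census.SelfHorizonB
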